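import Mathlib

/-!
# The principle of symmetric criticality (finite groups, Fréchet derivatives)

Palais' principle [Palais1979: Thm 4.4 (valid for admissible G-spaces) + Thm 5.1 (compact G ⇒ admissible),
here in the finite-group / linear-action / Fréchet-derivative form]: if a finite group `G` acts on a normed
space `E` by continuous linear maps, `Φ : E → ℝ` is `G`-invariant and Fréchet differentiable at a
`G`-fixed point `u`, and the derivative `φ = DΦ(u)` vanishes on the fixed subspace
`E^G = {v | ∀ g, ρ g v = v}`, then `φ = 0`, i.e. `u` is a critical point of `Φ` on all of `E`.

The proof is the group average: `φ ∘ ρ g = φ` for every `g` (differentiate `Φ ∘ ρ g = Φ` at the fixed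
point `u`), hence `φ w = φ (avg w)` with `avg w = (1/|G|) ∑ g, ρ g w ∈ E^G`, which is `0`.

Used by the pub-fluidc extreme-growth analysis (opt-bounds, ANALYSIS-OPT §4): a maximiser of the
KYP objective restricted to the fixed subspace of a discrete symmetry group of the periodic box
(e.g. the order-8 chiral screw group found for the top-branch optima) is automatically a critical point
of the UNRESTRICTED problem — a genuine candidate optimum, though not necessarily a maximum (the
second variation in symmetry-breaking directions decides that).
HONEST FRAMING: low prior, high value-of-information experiment on Tao's machine paradigm;
NOT a claim that NS blows up.
-/

namespace Literature.Analysis.Calculus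

open scoped BigOperators

variable {E : Type*} [NormedAddCommGroup E] [NormedSpace ℝ E]
variable {G : Type*} [Group G]

/-- The fixed subspace `E^G = {v | ∀ g, ρ g v = v}` (Palais' set `Σ` of symmetric points, linear case) of a
representation of `G` on `E` by continuous linear maps. [folklore] -/
def fixedSubspace (ρ : G →* (E →L[ℝ] E)) : Submodule ℝ E where
  carrier := {v | ∀ g : G, ρ g v = v}
  add_mem' := by
    intro a b ha hb g
    simp [map_add, ha g, hb g]
  zero_mem' := by
    intro g; simp
  smul_mem' := by
    intro c v hv g
    simp [map_smul, hv g]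

/-- Membership in the fixed subspace, unfolded. [folklore] -/
@[simp] lemma mem_fixedSubspace {ρ : G →* (E →L[ℝ] E)} {v : E} :
    v ∈ fixedSubspace ρ ↔ ∀ g : G, ρ g v = v := Iff.rfl

/-- The group average `A w = (1/|G|) ∑ g, ρ g w` ("averaging over the group", Palais 1979 §5, finite case). [folklore] -/
noncomputable def groupAverage [Fintype G] (ρ : G →* (E →L[ℝ] E)) (w : E) : E :=
  (Fintype.card G : ℝ)⁻¹ • ∑ g : G, ρ g w

/-- `A w ∈ E^G`: the average of an orbit is a symmetric point [cite: Palais1979, §5 (properties of A)]. -/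
lemma groupAverage_mem_fixedSubspace [Fintype G] (ρ : G →* (E →L[ℝ] E)) (w : E) :
    groupAverage ρ w ∈ fixedSubspace ρ := by
  intro h
  unfold groupAverage
  rw [map_smul, map_sum]
  congr 1
  -- reindex the sum by left multiplication with h
  have : ∑ g : G, ρ h (ρ g w) = ∑ g : G, ρ (h * g) w := by
    refine Finset.sum_congr rfl ?_
    intro g _
    rw [map_mul]; rfl
  rw [this]
  exact Fintype.sum_equiv (Equiv.mulLeft h) _ _ (fun g => rfl)

/-- An invariant continuous linear functional satisfies `l (A w) = l w` [cite: Palais1979, §5 (third property of A)]. -/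
lemma apply_eq_apply_groupAverage [Fintype G] (ρ : G →* (E →L[ℝ] E)) (φ : E →L[ℝ] ℝ)
    (hφ : ∀ g : G, φ.comp (ρ g) = φ) (w : E) : φ w = φ (groupAverage ρ w) := by
  unfold groupAverage
  rw [map_smul, map_sum]
  have h1 : ∀ g : G, φ (ρ g w) = φ w := by
    intro g
    have := congrArg (fun (ψ : E →L[ℝ] ℝ) => ψ w) (hφ g)
    simpa using this
  simp only [h1, Finset.sum_const, Finset.card_univ, nsmul_eq_mul, smul_eq_mul]
  have : Nonempty G := ⟨1⟩
  have hc : (Fintype.card G : ℝ) ≠ 0 := by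
    exact_mod_cast Fintype.card_ne_zero
  field_simp

/-- **Principle of symmetric criticality** (Palais 1979; finite group, Fréchet form).
If `Φ` is `G`-invariant, differentiable at a `G`-fixed point `u` with derivative `φ`, and `φ` vanishes on
the fixed subspace `E^G`, then `φ = 0` — "critical symmetric points are symmetric critical points"
[cite: Palais1979, Thm 5.1 with Thm 4.4 (compact — here finite — group acting linearly on a Banach space)]. -/
theorem symmetric_criticality [Fintype G] (ρ : G →* (E →L[ℝ] E)) {Φ : E → ℝ} {φ : E →L[ℝ] ℝ} {u : E}
    (hΦ : ∀ (g : G) (v : E), Φ (ρ g v) = Φ v) (hu : u ∈ fixedSubspace ρ)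
    (hd : HasFDerivAt Φ φ u) (hcrit : ∀ v ∈ fixedSubspace ρ, φ v = 0) : φ = 0 := by
  -- invariance of the derivative: φ ∘ ρ g = φ
  have hφ : ∀ g : G, φ.comp (ρ g) = φ := by
    intro g
    have hug : ρ g u = u := hu g
    -- Φ ∘ ρ g = Φ, and ρ g is its own derivative
    have h1 : HasFDerivAt (Φ ∘ ρ g) (φ.comp (ρ g)) u := by
      have hρ : HasFDerivAt (ρ g : E → E) (ρ g) u := (ρ g).hasFDerivAt
      have hd' : HasFDerivAt Φ φ (ρ g u) := by rw [hug]; exact hd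
      exact hd'.comp u hρ
    have h2 : (Φ ∘ ρ g) = Φ := by
      funext v; exact hΦ g v
    rw [h2] at h1
    exact h1.unique hd
  ext w
  rw [apply_eq_apply_groupAverage ρ φ hφ w]
  simpa using hcrit _ (groupAverage_mem_fixedSubspace ρ w)

/-- Corollary in the form used by the analysis: a critical point of the RESTRICTION of a `G`-invariant
functional to the fixed subspace (derivative vanishing on `E^G`) is a critical point of the functional
(`HasFDerivAt Φ 0 u`) [cite: Palais1979, Thm 5.1 with Thm 4.4 (finite group, linear action)]. -/
theorem hasFDerivAt_zero_of_symmetric_criticality [Fintype G] (ρ : G →* (E →L[ℝ] E)) {Φ : E → ℝ}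
    {φ : E →L[ℝ] ℝ} {u : E} (hΦ : ∀ (g : G) (v : E), Φ (ρ g v) = Φ v) (hu : u ∈ fixedSubspace ρ)
    (hd : HasFDerivAt Φ φ u) (hcrit : ∀ v ∈ fixedSubspace ρ, φ v = 0) : HasFDerivAt Φ (0 : E →L[ℝ] ℝ) u := by
  have := symmetric_criticality ρ hΦ hu hd hcrit
  simpa [this] using hd

/-- Equivariant maps preserve the fixed subspace: if `F (ρ g v) = ρ g (F v)` for all `g, v` (e.g. the time-`t`
solution map of a `G`-equivariant evolution equation, such as Navier–Stokes on the periodic box under the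
box's isometries), then `F` maps `E^G` into `E^G` — symmetric data stay symmetric. [folklore] -/
lemma map_mem_fixedSubspace_of_equivariant (ρ : G →* (E →L[ℝ] E)) {F : E → E}
    (hF : ∀ (g : G) (v : E), F (ρ g v) = ρ g (F v)) {u : E} (hu : u ∈ fixedSubspace ρ) :
    F u ∈ fixedSubspace ρ := by
  intro g
  rw [← hF g u, hu g]

/-- The group average is the identity on the fixed subspace (`A v = v` for symmetric `v`). [folklore] -/
lemma groupAverage_eq_self_of_mem [Fintype G] (ρ : G →* (E →L[ℝ] E)) {v : E}
    (hv : v ∈ fixedSubspace ρ) : groupAverage ρ v = v := by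
  have : Nonempty G := ⟨1⟩
  unfold groupAverage
  have h1 : ∀ g : G, ρ g v = v := hv
  simp only [h1, Finset.sum_const, Finset.card_univ]
  rw [← Nat.cast_smul_eq_nsmul ℝ, smul_smul, inv_mul_cancel₀ (by exact_mod_cast Fintype.card_ne_zero), one_smul]

end Literature.Analysis.Calculus
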